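import Literature.NumberTheory.IwasawaTheory.SinnottNormDistribution
import HarnessLib

/-!
# Sinnott's norm element IS a field norm: `N_{ℚ(μ_t)/ℚ(μ_t) ∩ k}(1 − ζ^a)` (the tree's `sinnottNorm k ζ a`, a product over
# exponents) equals Mathlib's `Algebra.norm k (1 − ζ^a)` for `k ⊆ ℚ(ζ)` — proved, no named fact

Topic `NumberTheory/IwasawaTheory`; namespace `Literature.NumberTheory.IwasawaTheory.CyclotomicUnits` (continues F4's
`CyclotomicColemanMap.lean` §1 and `SinnottNormDistribution.lean`).  Cell bsd-cm, seat bsd-cm-k-ty1 g24 (literature-prover),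
serving `stmt-BirchSwinnertonDyer-19945` (the `𝒞₇` genus road, input (3b′) of K1ᵘ: with this dictionary the global norm relation
`N_{K_{n+1}/K_n}(ξ_{n+1}) = ξ_n` of the Sinnott family is TRANSITIVITY of `Algebra.norm` (Mathlib `Algebra.norm_norm`) followed by
the distribution relation `sinnottNorm_succ_eq_sinnottNorm`).

WHAT.  For a primitive `t`-th root of unity `ζ ∈ ℚ̄`, `M = ℚ(ζ) ⊆ ℚ̄`, a subfield `k ≤ M` (so `M` is a `k`-algebra through the
inclusion, finite and Galois since `M/ℚ` is abelian):
* §1 `algEquiv_eq_of_apply_gen_eq` — `k`-automorphisms of `M` agreeing on `ζ` are equal (`M = ℚ(ζ)`); `exists_exponent` — every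
  `k`-automorphism `σ` of `M` has an exponent `c < t`, `σ ζ = ζ^c`, which lies in `sinnottExponents k ζ` (lift `σ` to `ℚ̄`);
  `exists_algEquiv_of_mem_sinnottExponents` — conversely every `b ∈ sinnottExponents k ζ` is the exponent of a `k`-automorphism
  of `M` (restrict a `k`-fixing automorphism of `ℚ̄` to the normal subfield `M`).
* §2 ★ `coe_norm_one_sub_pow_eq_sinnottNorm` — `((Algebra.norm k (1 − ζ^a) : k) : ℚ̄) = sinnottNorm k ζ a`: the norm is the product
  over `Gal(M/k)` (Mathlib `Algebra.norm_eq_prod_automorphisms`), reindexed by the bijection `σ ↦ c_σ` onto `sinnottExponents k ζ`.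

PRINT. T. Tsuji, J. Number Theory 78 (1999) §6 (p. 20): «`N_{ℚ(μ_t)/ℚ(μ_t) ∩ k}(1 − ζ_t^a)`»; S. Lang, *Cyclotomic Fields I–II* (1990)
Ch. 6 §1; L. Washington, *Introduction to Cyclotomic Fields* (1997) Thm. 2.5 (`Gal(ℚ(ζ_n)/ℚ) ≅ (ℤ/nℤ)^×`).  All theorems; no
definition, no instance, no named fact.  HONEST FRAMING: a dictionary lemma; nothing about BSD.

## References
* [Tsuji1999] T. Tsuji, Semi-local units modulo cyclotomic units, J. Number Theory 78 (1999) 1–26, §6 (p. 20).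
* [Lang1990] S. Lang, *Cyclotomic Fields I and II*, GTM 121 (1990), Ch. 6 §1.
* [Washington1997] L. C. Washington, *Introduction to Cyclotomic Fields*, 2nd ed., GTM 83 (1997), Thm. 2.5.
-/

noncomputable section

open Polynomial Field
open Literature.NumberTheory.ComplexMultiplication.EllipticUnits

namespace Literature.NumberTheory.IwasawaTheory

namespace CyclotomicUnits

variable (k : IntermediateField ℚ (AlgebraicClosure ℚ)) {t : ℕ}

/-! ### §1. `k`-automorphisms of `ℚ(ζ)` and Sinnott's exponents -/

/-- `k`-automorphisms of `M = ℚ(ζ)` that agree on `ζ` are equal. [cite: Washington1997, Thm. 2.5] -/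
theorem algEquiv_eq_of_apply_gen_eq {ζ : AlgebraicClosure ℚ} (hk : k ≤ IntermediateField.adjoin ℚ {ζ})
    (σ τ : letI := (IntermediateField.inclusion hk).toRingHom.toAlgebra;
      IntermediateField.adjoin ℚ {ζ} ≃ₐ[k] IntermediateField.adjoin ℚ {ζ})
    (h : σ (IntermediateField.AdjoinSimple.gen ℚ ζ) = τ (IntermediateField.AdjoinSimple.gen ℚ ζ)) : σ = τ := by
  letI := (IntermediateField.inclusion hk).toRingHom.toAlgebra
  haveI : IsScalarTower ℚ k (IntermediateField.adjoin ℚ {ζ}) := IsScalarTower.of_algebraMap_eq fun q => by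
    rw [eq_ratCast (algebraMap ℚ _), eq_ratCast (algebraMap ℚ k), RingHom.algebraMap_toAlgebra, map_ratCast]
  have hres : (σ.restrictScalars ℚ : IntermediateField.adjoin ℚ {ζ} →ₐ[ℚ] IntermediateField.adjoin ℚ {ζ}) =
      (τ.restrictScalars ℚ : IntermediateField.adjoin ℚ {ζ} →ₐ[ℚ] IntermediateField.adjoin ℚ {ζ}) := by
    refine IntermediateField.adjoin_algHom_ext ℚ fun x hx => ?_
    rw [Set.mem_singleton_iff] at hx
    subst hx
    exact h
  ext x
  have := congrArg (fun f : IntermediateField.adjoin ℚ {ζ} →ₐ[ℚ] IntermediateField.adjoin ℚ {ζ} => f x) hres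
  exact congrArg Subtype.val this

/-- **Every `k`-automorphism of `ℚ(ζ)` has an exponent in `sinnottExponents k ζ`**: `σ ζ = ζ^c` with `c < t`, and `c` is realised
by an automorphism of `ℚ̄` fixing `k` (lift `σ`). [cite: Tsuji1999, §6 (p. 20)] [cite: Washington1997, Thm. 2.5] -/
theorem exists_exponent (ht : 0 < t) {ζ : AlgebraicClosure ℚ} (hζ : IsPrimitiveRoot ζ t)
    (hk : k ≤ IntermediateField.adjoin ℚ {ζ})
    (σ : letI := (IntermediateField.inclusion hk).toRingHom.toAlgebra;
      IntermediateField.adjoin ℚ {ζ} ≃ₐ[k] IntermediateField.adjoin ℚ {ζ}) :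
    ∃ c : ℕ, c < t ∧ (c : ZMod t) ∈ sinnottExponents (t := t) k ζ ∧
      σ (IntermediateField.AdjoinSimple.gen ℚ ζ) = IntermediateField.AdjoinSimple.gen ℚ ζ ^ c := by
  letI := (IntermediateField.inclusion hk).toRingHom.toAlgebra
  haveI : IsScalarTower ℚ k (IntermediateField.adjoin ℚ {ζ}) := IsScalarTower.of_algebraMap_eq fun q => by
    rw [eq_ratCast (algebraMap ℚ _), eq_ratCast (algebraMap ℚ k), RingHom.algebraMap_toAlgebra, map_ratCast]
  haveI : NeZero t := ⟨ht.ne'⟩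
  haveI hN : Normal ℚ (AlgebraicClosure ℚ) :=
    @IsAlgClosure.normal ℚ (AlgebraicClosure ℚ) _ _ (AlgebraicClosure.instAlgebra ℚ)
      (inferInstance : @IsAlgClosure ℚ (AlgebraicClosure ℚ) _ _ (AlgebraicClosure.instAlgebra ℚ) _)
  have hζM : IsPrimitiveRoot (IntermediateField.AdjoinSimple.gen ℚ ζ) t :=
    IsPrimitiveRoot.coe_submonoidClass_iff.mp (by rw [IntermediateField.AdjoinSimple.coe_gen]; exact hζ)
  obtain ⟨c, hct, hc⟩ := hζM.eq_pow_of_pow_eq_one (ξ := σ (IntermediateField.AdjoinSimple.gen ℚ ζ))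
    (by rw [← map_pow, hζM.pow_eq_one, map_one])
  refine ⟨c, hct, ?_, hc.symm⟩
  -- lift `σ` (restricted to `ℚ`) to an automorphism of `ℚ̄`; it fixes `k` and sends `ζ ↦ ζ^c`
  set σ' : AlgebraicClosure ℚ ≃ₐ[ℚ] AlgebraicClosure ℚ := (σ.restrictScalars ℚ).liftNormal (AlgebraicClosure ℚ) with hσ'
  have hlift : ∀ x : IntermediateField.adjoin ℚ {ζ}, σ' (x : AlgebraicClosure ℚ) = ((σ x : IntermediateField.adjoin ℚ {ζ}) :
      AlgebraicClosure ℚ) := fun x =>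
    AlgEquiv.liftNormal_commutes (σ.restrictScalars ℚ) (AlgebraicClosure ℚ) x
  refine (mem_sinnottExponents_iff k ζ _).mpr ⟨(absoluteGaloisGroup.toAlgEquiv ℚ).symm σ', fun x hx => ?_, ?_⟩
  · rw [MulEquiv.apply_symm_apply]
    have h1 := hlift (IntermediateField.inclusion hk ⟨x, hx⟩)
    have h2 : σ (IntermediateField.inclusion hk ⟨x, hx⟩) = IntermediateField.inclusion hk ⟨x, hx⟩ := σ.commutes ⟨x, hx⟩
    rw [h2] at h1
    exact h1
  · rw [MulEquiv.apply_symm_apply, ZMod.val_natCast, Nat.mod_eq_of_lt hct]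
    have h1 := hlift (IntermediateField.AdjoinSimple.gen ℚ ζ)
    rw [← hc, SubmonoidClass.coe_pow, IntermediateField.AdjoinSimple.coe_gen] at h1
    exact h1

/-- **Conversely every Sinnott exponent is the exponent of a `k`-automorphism of `ℚ(ζ)`** (restrict a `k`-fixing automorphism of
`ℚ̄` with `ζ ↦ ζ^b` to the normal subfield `ℚ(ζ)`; it is `k`-linear). [cite: Tsuji1999, §6 (p. 20)] [cite: Washington1997, Thm. 2.5] -/
theorem exists_algEquiv_of_mem_sinnottExponents (ht : 0 < t) {ζ : AlgebraicClosure ℚ} (hζ : IsPrimitiveRoot ζ t)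
    (hk : k ≤ IntermediateField.adjoin ℚ {ζ}) {b : ZMod t} (hb : b ∈ sinnottExponents (t := t) k ζ) :
    ∃ σ : (letI := (IntermediateField.inclusion hk).toRingHom.toAlgebra;
      IntermediateField.adjoin ℚ {ζ} ≃ₐ[k] IntermediateField.adjoin ℚ {ζ}),
      σ (IntermediateField.AdjoinSimple.gen ℚ ζ) = IntermediateField.AdjoinSimple.gen ℚ ζ ^ b.val := by
  letI := (IntermediateField.inclusion hk).toRingHom.toAlgebra
  haveI : NeZero t := ⟨ht.ne'⟩
  haveI hII : Algebra.IsIntegral ℚ (AlgebraicClosure ℚ) :=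
    @Algebra.IsAlgebraic.isIntegral ℚ (AlgebraicClosure ℚ) _ _ (AlgebraicClosure.instAlgebra ℚ)
      (AlgebraicClosure.isAlgebraic (k := ℚ))
  haveI hcyc : IsCyclotomicExtension {t} ℚ (IntermediateField.adjoin ℚ {ζ}) :=
    IsPrimitiveRoot.intermediateField_adjoin_isCyclotomicExtension ℚ hζ
  haveI : IsGalois ℚ (IntermediateField.adjoin ℚ {ζ}) := IsCyclotomicExtension.isGalois {t} ℚ _
  obtain ⟨τ, hτk, hτζ⟩ := (mem_sinnottExponents_iff k ζ b).mp hb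
  -- restrict the `k`-fixing automorphism `τ` of `ℚ̄` to the normal subfield `ℚ(ζ)`
  set τ₀ : IntermediateField.adjoin ℚ {ζ} ≃ₐ[ℚ] IntermediateField.adjoin ℚ {ζ} :=
    AlgEquiv.restrictNormal (absoluteGaloisGroup.toAlgEquiv ℚ τ) (IntermediateField.adjoin ℚ {ζ}) with hτ₀
  have hτ₀v : ∀ x : IntermediateField.adjoin ℚ {ζ}, ((τ₀ x : IntermediateField.adjoin ℚ {ζ}) : AlgebraicClosure ℚ) =
      absoluteGaloisGroup.toAlgEquiv ℚ τ (x : AlgebraicClosure ℚ) := fun x =>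
    AlgEquiv.restrictNormal_commutes (absoluteGaloisGroup.toAlgEquiv ℚ τ) (IntermediateField.adjoin ℚ {ζ}) x
  refine ⟨{ τ₀ with commutes' := fun r => ?_ }, ?_⟩
  · apply Subtype.ext
    change ((τ₀ (IntermediateField.inclusion hk r) : IntermediateField.adjoin ℚ {ζ}) : AlgebraicClosure ℚ) =
      ((IntermediateField.inclusion hk r : IntermediateField.adjoin ℚ {ζ}) : AlgebraicClosure ℚ)
    rw [hτ₀v, IntermediateField.coe_inclusion]
    exact hτk r r.2
  · apply Subtype.ext
    change ((τ₀ (IntermediateField.AdjoinSimple.gen ℚ ζ) : IntermediateField.adjoin ℚ {ζ}) : AlgebraicClosure ℚ) = _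
    rw [hτ₀v, IntermediateField.AdjoinSimple.coe_gen, hτζ, SubmonoidClass.coe_pow, IntermediateField.AdjoinSimple.coe_gen]

/-! ### §2. `sinnottNorm k ζ a` is the field norm `N_{ℚ(ζ)/k}(1 − ζ^a)` -/

/-- ★ **Sinnott's norm element is the field norm**: for `k ⊆ ℚ(ζ) = M`,
`((Algebra.norm k (1 − ζ^a : M) : k) : ℚ̄) = sinnottNorm k ζ a = ∏_{b ∈ sinnottExponents k ζ} (1 − ζ^{ab})` — the norm is the
product over `Gal(M/k)` (Mathlib), reindexed by the bijection `σ ↦ c_σ` of §1 onto Sinnott's exponent set.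
[cite: Tsuji1999, §6 (p. 20, «N_{ℚ(μ_t)/ℚ(μ_t)∩k}(1 − ζ_t^a)»)] [cite: Lang1990, Ch. 6 §1] -/
theorem coe_norm_one_sub_pow_eq_sinnottNorm (ht : 0 < t) {ζ : AlgebraicClosure ℚ} (hζ : IsPrimitiveRoot ζ t)
    (hk : k ≤ IntermediateField.adjoin ℚ {ζ}) (a : ℕ) :
    letI := (IntermediateField.inclusion hk).toRingHom.toAlgebra;
    ((Algebra.norm k (1 - IntermediateField.AdjoinSimple.gen ℚ ζ ^ a : IntermediateField.adjoin ℚ {ζ}) : k) :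
        AlgebraicClosure ℚ) = sinnottNorm (t := t) k ζ a := by
  classical
  letI := (IntermediateField.inclusion hk).toRingHom.toAlgebra
  haveI : IsScalarTower ℚ k (IntermediateField.adjoin ℚ {ζ}) := IsScalarTower.of_algebraMap_eq fun q => by
    rw [eq_ratCast (algebraMap ℚ _), eq_ratCast (algebraMap ℚ k), RingHom.algebraMap_toAlgebra, map_ratCast]
  haveI : NeZero t := ⟨ht.ne'⟩
  haveI hII : Algebra.IsIntegral ℚ (AlgebraicClosure ℚ) :=
    @Algebra.IsAlgebraic.isIntegral ℚ (AlgebraicClosure ℚ) _ _ (AlgebraicClosure.instAlgebra ℚ)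
      (AlgebraicClosure.isAlgebraic (k := ℚ))
  haveI hcyc : IsCyclotomicExtension {t} ℚ (IntermediateField.adjoin ℚ {ζ}) :=
    IsPrimitiveRoot.intermediateField_adjoin_isCyclotomicExtension ℚ hζ
  haveI : FiniteDimensional ℚ (IntermediateField.adjoin ℚ {ζ}) := IsCyclotomicExtension.finiteDimensional {t} ℚ _
  haveI : IsGalois ℚ (IntermediateField.adjoin ℚ {ζ}) := IsCyclotomicExtension.isGalois {t} ℚ _
  haveI : FiniteDimensional k (IntermediateField.adjoin ℚ {ζ}) :=
    Module.Finite.of_restrictScalars_finite ℚ k (IntermediateField.adjoin ℚ {ζ})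
  haveI : IsGalois k (IntermediateField.adjoin ℚ {ζ}) := IsGalois.tower_top_of_isGalois ℚ k (IntermediateField.adjoin ℚ {ζ})
  have hζM : IsPrimitiveRoot (IntermediateField.AdjoinSimple.gen ℚ ζ) t :=
    IsPrimitiveRoot.coe_submonoidClass_iff.mp (by rw [IntermediateField.AdjoinSimple.coe_gen]; exact hζ)
  -- exponents of the `k`-automorphisms
  have hex := fun σ : IntermediateField.adjoin ℚ {ζ} ≃ₐ[k] IntermediateField.adjoin ℚ {ζ} =>
    exists_exponent k ht hζ hk σ
  choose c hct hcS hcσ using hex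
  -- the norm as a product over `Gal(M/k)`, read in `ℚ̄`
  have hprod := Algebra.norm_eq_prod_automorphisms k
    (1 - IntermediateField.AdjoinSimple.gen ℚ ζ ^ a : IntermediateField.adjoin ℚ {ζ})
  have hlhs : ((Algebra.norm k (1 - IntermediateField.AdjoinSimple.gen ℚ ζ ^ a : IntermediateField.adjoin ℚ {ζ}) : k) :
      AlgebraicClosure ℚ) = ∏ σ : IntermediateField.adjoin ℚ {ζ} ≃ₐ[k] IntermediateField.adjoin ℚ {ζ},
        (1 - ζ ^ (a * c σ)) := by
    have h1 : ((Algebra.norm k (1 - IntermediateField.AdjoinSimple.gen ℚ ζ ^ a : IntermediateField.adjoin ℚ {ζ}) : k) :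
        AlgebraicClosure ℚ) = ((algebraMap k (IntermediateField.adjoin ℚ {ζ})
          (Algebra.norm k (1 - IntermediateField.AdjoinSimple.gen ℚ ζ ^ a : IntermediateField.adjoin ℚ {ζ})) :
            IntermediateField.adjoin ℚ {ζ}) : AlgebraicClosure ℚ) := by
      rw [RingHom.algebraMap_toAlgebra]
      exact (IntermediateField.coe_inclusion hk _).symm
    rw [h1, hprod, SubmonoidClass.coe_finsetProd]
    refine Finset.prod_congr rfl fun σ _ => ?_
    rw [map_sub, map_one, map_pow, hcσ σ, ← pow_mul, mul_comm, AddSubgroupClass.coe_sub, OneMemClass.coe_one,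
      SubmonoidClass.coe_pow, IntermediateField.AdjoinSimple.coe_gen]
  -- the exponent map is a bijection onto Sinnott's exponent set
  have himage : (Set.toFinite (sinnottExponents (t := t) k ζ)).toFinset =
      Finset.univ.image (fun σ : IntermediateField.adjoin ℚ {ζ} ≃ₐ[k] IntermediateField.adjoin ℚ {ζ} => (c σ : ZMod t)) := by
    ext b
    simp only [Set.Finite.mem_toFinset, Finset.mem_image, Finset.mem_univ, true_and]
    constructor
    · intro hb
      obtain ⟨σ, hσ⟩ := exists_algEquiv_of_mem_sinnottExponents k ht hζ hk hb
      refine ⟨σ, ?_⟩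
      have h1 : IntermediateField.AdjoinSimple.gen ℚ ζ ^ c σ = IntermediateField.AdjoinSimple.gen ℚ ζ ^ b.val := by
        rw [← hcσ σ, hσ]
      have h2 : c σ = b.val := hζM.pow_inj (hct σ) (ZMod.val_lt b) h1
      rw [h2, ZMod.natCast_zmod_val]
    · rintro ⟨σ, rfl⟩
      exact hcS σ
  have hinj : Set.InjOn (fun σ : IntermediateField.adjoin ℚ {ζ} ≃ₐ[k] IntermediateField.adjoin ℚ {ζ} => (c σ : ZMod t))
      ↑(Finset.univ : Finset (IntermediateField.adjoin ℚ {ζ} ≃ₐ[k] IntermediateField.adjoin ℚ {ζ})) := by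
    intro σ _ τ _ h
    have h1 : c σ = c τ := by
      have := (ZMod.natCast_eq_natCast_iff' (c σ) (c τ) t).mp h
      rwa [Nat.mod_eq_of_lt (hct σ), Nat.mod_eq_of_lt (hct τ)] at this
    refine algEquiv_eq_of_apply_gen_eq k hk σ τ ?_
    rw [hcσ σ, hcσ τ, h1]
  rw [hlhs, sinnottNorm, finprod_mem_eq_finite_toFinset_prod _ (Set.toFinite _), himage, Finset.prod_image hinj]
  refine Finset.prod_congr rfl fun σ _ => ?_
  rw [ZMod.val_natCast, Nat.mod_eq_of_lt (hct σ)]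

end CyclotomicUnits

end Literature.NumberTheory.IwasawaTheory
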